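import Summits.BirchSwinnertonDyer.BirchSwinnertonDyer.Theses.KatoDescentTamePotSupersingular
import Summits.BirchSwinnertonDyer.BirchSwinnertonDyer.Theorems.PotSupersingularIrreducibleClassTransport
import Summits.BirchSwinnertonDyer.Rank1Residual.Supersingular.DescentLowerBound
import Literature.NumberTheory.EllipticCurves.Rank1Residual.Typed.CasselsLowerBound
import Literature.NumberTheory.EllipticCurves.NonEisensteinPrimeOfSurjective
import Literature.NumberTheory.EllipticCurves.IsogenyIdProofs
import HarnessLib

/-!
# Route `KatoDescentTamePotSupersingular` (rung K8-t′, cell `bsd-potss`): the DESCENT-CERTIFICATE road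
# to the open core `TameLowerIntrinsicNonCM` (item stmt-BirchSwinnertonDyer-19618, child of the crux L₀
# `TameLowerHalfRankZero` 19981) — one `p`-torsion class of `Ш` (or one non-zero `p`-Selmer class) at a
# SHALLOW member + the Cassels–Tate square + Cassels' transport (a `--supports … --as helper` file)

The open core asks, on every INTRINSIC NON-CM (t′) class of analytic rank `0` (additive tame `p`,
`e ∈ {3,4,6}`, every globally minimal member has `p ∣ #Ш_an`), the LOWER bound
`ord_p #Ш_an(W) ≤ ord_p #Ш(W)` (`MissingLowerBoundAt W p`). Class-wide this is Kato's Conj. 12.10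
(lower inclusion) at an additive potentially supersingular prime — open off the Fouquet seed rows
(k8t-c2 g0–g5). PER CLASS it is a finite computation whenever the class is SHALLOW (some member `W′`
has `ord_p #Ш_an(W′) ≤ 2`; census at `p = 3`: 894 of the 901 irreducible intrinsic (t′) content classes
`N < 5·10⁵`, all 7 others have `ord₃ #Ш_an = 4`), and this file types the interface, UNIFORMLY IN `p`,
as the third road to 19618 next to the Kim/Kurihara road (`…TameLowerKimRoad`) and the Fouquet seed
road (`…TameLowerFouquetRoadCited*`):

* §1 (any prime `p`, any analytic-rank-`0` curve; class transport): ONE non-zero `x ∈ Ш(W′)` with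
  `p • x = 0` — or ONE non-zero class in `Sel^{(p)}(W′/ℚ)` with `p ∤ #W′(ℚ)_tors` — at a globally
  minimal `W′ ∼_ℚ W` with `ord_p #Ш_an(W′) ≤ 2` gives `MissingLowerBoundAt W p` (rung K9's generation-2
  lemma `missingLowerBoundAt_of_torsionWitness_of_le_two` / the cell's
  `Supersingular.missingLowerBoundAt_of_casselsTate_of_selmerGroup_ne_bot` at `W′`, then Cassels'
  transport of the lower half `TwistComparison.missingLowerBoundAt_of_isIsogenous`). Rung K9's
  `missingLowerBoundAt_wild_of_isIsogenous_shallowWitness` is the instance `p = 3` decorated with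
  `ClassO6`; here no class predicate is carried, so both routes (and any additive prime) may cite it.
* §2 (irreducible rows, per curve): with `W[p]` irreducible the certificate may sit at `W` itself and
  no transport is needed (`p ∤ #W(ℚ)_tors` is automatic, `Supersingular.not_dvd_torsionOrder_of_irr`);
  on such rows "intrinsic" and "shallow" are per-curve conditions (k9-c2 g6,
  `forall_isIsogenous_shaAn_pos_iff_of_irr`).
* §3 (`p = 3`, the `3`-adic tower onto ⇒ `W[3]` irreducible): the registered BC5 rung
  `Sig.stub_intr_three_e4_rung` of the 19618 skeleton (v4) VERBATIM — L₀ on the tower-onto intrinsic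
  non-CM (t′) rows at `3` (Kodaira III/III*, `e = 4`) — from the four PUBLISHED inputs (Cassels–Tate,
  Cassels, GZK, modularity), ONE Selmer certificate per SHALLOW tower row, and the DEEP tower rows
  (`ord₃ #Ш_an ≥ 3`; census: 7 classes) displayed. Unlike the Kim lane
  (`tameLowerHalf_three_e4_rung_of_kimAtThree_of_certs_of_typeIIIRows`, which rests on the cell theorem
  `N11.KimAtThreeRankZeroPUB` and needs `E(ℚ₃)[3] = 0`), this lane has NO unrefereed input and no
  `t`-binder: the type-`III` rows with a local `3`-torsion point are certificate rows too.
* §4 the child crux `TameLowerIntrinsicNonCM` BY NAME (every odd `p`) from the published inputs, ONE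
  certificate per SHALLOW intrinsic non-CM class (witness currency `hwit`, or Selmer currency `hSel`),
  and the DEEP classes displayed (`hdeep`).

HONEST LABEL: a witness `x ∈ Ш(W′)[p] ∖ 0` / a non-zero `p`-Selmer class is an OBJECT the tree cannot
construct today; the hypotheses `hwit` / `hSel` are per-class certificate SLOTS (filled per class by an
explicit `p`-descent — Schaefer–Stoll at `p = 3` on the irreducible rows, `p`-isogeny descent on the
reducible ones), so every theorem here is conditional and the item is NOT closed. Class-wide, "every
shallow intrinsic class has a witness" is the open core again (in rank `0`, `Ш[p] ≠ 0 ⟸ p ∣ #Ш_an` IS the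
lower half truncated at `1`). Nothing is booked. Seat `bsd-potss-k8t-c2` (prover-bsd-potss-k8t-c2-g6-0).

References: [SilvermanAEC2009] Thm. X.4.14 (Cassels–Tate: a finite `Ш` has square order), Cor. III.4.11;
[Cassels1965ArithmeticVIII] / [MilneADT2006] Thm. I.7.3 (isogeny invariance of the BSD quotient);
[Miller2011LMS] Def. 1.1; [Kato2004Asterisque] Conj. 12.10 (p. 224); [SchaeferStoll2004] (explicit
`p`-descent, the certificate engine); [GrossZagier1986], [Kolyvagin1990] (GZK).

MAINTENANCE (seat `bsd-potss-k8t-c2` g7, prover-bsd-potss-k8t-c2-g7-0): statements unchanged; the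
module no longer imports rung K9's `Theorems.KatoDescentPotSupersingularWildLowerShaWitness` (which
imports the K9 route file — gate lint `theses-cone` on p462525: every K9 route edit rebuilt this file):
the one K9 lemma used in §1 (`missingLowerBoundAt_of_torsionWitness_of_le_two`) is replaced by the
ROUTE-FREE Literature lemmas `Typed.dvd_shaOrder_of_exists_torsion` +
`Typed.missingLowerBoundAt_of_casselsTate_of_pow_dvd` (`Rank1Residual/Typed/CasselsLowerBound.lean`,
cell b2b-bsdres), which prove the same step. The only route file in this module's cone is its own.
-/

set_option autoImplicit false
-- sibling precedent (`KatoDescentTamePotSupersingularTameLowerKimRoad.lean`): the directory name repeats the summit name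
set_option linter.dupNamespace false

noncomputable section

open scoped Classical

namespace Summit.BirchSwinnertonDyer.BirchSwinnertonDyer.Theorems

open WeierstrassCurve Literature.NumberTheory.EllipticCurves
  Literature.NumberTheory.EllipticCurves.Rank1Residual
  Literature.NumberTheory.EllipticCurves.Rank1Residual.Typed
  Summit.BirchSwinnertonDyer.Rank1Residual.Additive
  Summit.BirchSwinnertonDyer.Rank1Residual
  Summit.BirchSwinnertonDyer.BirchSwinnertonDyer.Theses.KatoDescentTamePotSupersingular

/-! ## §1 Any prime `p`: a shallow certificate at one member gives L₀ at every member -/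

section AnyPrime

variable (W : WeierstrassCurve ℚ) [W.IsElliptic] [W.IsGloballyMinimal] (p : ℕ) [Fact p.Prime]
  (W' : WeierstrassCurve ℚ) [W'.IsElliptic] [W'.IsGloballyMinimal]

/-- **L₀ at EVERY member of a class one of whose members is shallow with a `p`-torsion witness** (any
prime `p`, any reduction type). For `W` globally minimal of analytic rank `0`: if SOME globally minimal
`W′ ∼_ℚ W` has `#Ш_an(W′) = q′` with `ord_p q′ ≤ 2` and a nonzero `x ∈ Ш(W′)` with `p • x = 0`, then
`MissingLowerBoundAt W p` — rung K9's `missingLowerBoundAt_of_torsionWitness_of_le_two` at `W′`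
(Cassels–Tate `hCT`: `p² ∣ #Ш(W′)`; GZK `hGZK`: `Ш(W′)` finite), then Cassels' transport of the lower
half along the class (`TwistComparison.missingLowerBoundAt_of_isIsogenous`, over Cassels `hCassels`,
GZK and modularity `hmod`). Rung K9's `missingLowerBoundAt_wild_of_isIsogenous_shallowWitness` is the
instance `p = 3`. Conditional on the four published facts and the witness slot.
[cite: SilvermanAEC2009, Thm. X.4.14] [cite: MilneADT2006, Thm. I.7.3] [cite: Miller2011LMS, Def. 1.1] -/
theorem missingLowerBoundAt_rankZero_of_isIsogenous_shallowWitness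
    (hCT : exists_casselsTate_pairing (K := ℚ)) (hCassels : bsdRHS_eq_of_isIsogenous)
    (hGZK : rank_eq_analyticRank_of_analyticRank_le_one) (hmod : hasEntireLFunction_rat)
    (hr : W.analyticRank = 0) (hiso : IsIsogenous W W') {q' : ℚ} (hq' : shaAn W' = (q' : ℂ))
    (hv' : padicValRat p q' ≤ 2) {x : W'.sha} (hx : x ≠ 0) (hpx : p • x = 0) :
    MissingLowerBoundAt W p := by
  have hr' : W'.analyticRank ≤ 1 := by
    rw [← analyticRank_eq_of_isIsogenous' hiso, hr]; exact zero_le_one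
  -- at `W'`: the witness gives `p ∣ #Ш(W')` (`Typed.dvd_shaOrder_of_exists_torsion`), Cassels–Tate
  -- squareness gives `p² ∣ #Ш(W')`, i.e. the lower half for `ord_p q' ≤ 2 = 2·1`
  -- (`Typed.missingLowerBoundAt_of_casselsTate_of_pow_dvd` with `k = 1`) — the Literature lemmas of
  -- `Rank1Residual/Typed/CasselsLowerBound.lean` (route-free), replacing rung K9's copy
  have hW' : MissingLowerBoundAt W' p :=
    missingLowerBoundAt_of_casselsTate_of_pow_dvd W' p hCT (hGZK W' hr').2 hq' (k := 1)
      (by simpa using hv') (by simpa using dvd_shaOrder_of_exists_torsion W' p ⟨x, hx, hpx⟩)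
  exact TwistComparison.missingLowerBoundAt_of_isIsogenous W' W p hCassels hGZK hmod
    hiso.symm_of_charZero hr' hW'

/-- **The same in SELMER currency** (what a `p`-descent engine actually outputs): if SOME globally
minimal `W′ ∼_ℚ W` has `#Ш_an(W′) = q′` with `ord_p q′ ≤ 2`, `p ∤ #W′(ℚ)_tors` and
`Sel^{(p)}(W′/ℚ) ≠ 0`, then `MissingLowerBoundAt W p` (rank `0` and no rational `p`-torsion turn the
Selmer class into a nonzero element of `Ш(W′)[p]`: the cell's
`Supersingular.missingLowerBoundAt_of_casselsTate_of_selmerGroup_ne_bot`; then Cassels' transport).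
Conditional on the four published facts and the certificate slot.
[cite: SilvermanAEC2009, Thm. X.4.14] [cite: MilneADT2006, Thm. I.7.3] [cite: Miller2011LMS, Def. 1.1] -/
theorem missingLowerBoundAt_rankZero_of_isIsogenous_shallowSelmer
    (hCT : exists_casselsTate_pairing (K := ℚ)) (hCassels : bsdRHS_eq_of_isIsogenous)
    (hGZK : rank_eq_analyticRank_of_analyticRank_le_one) (hmod : hasEntireLFunction_rat)
    (hr : W.analyticRank = 0) (hiso : IsIsogenous W W') (htors' : ¬ p ∣ W'.torsionOrder) {q' : ℚ}
    (hq' : shaAn W' = (q' : ℂ)) (hv' : padicValRat p q' ≤ 2) (hSel' : W'.selmerGroup (p : ℤ) ≠ ⊥) :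
    MissingLowerBoundAt W p := by
  have hra' : W'.analyticRank = 0 := by rw [← analyticRank_eq_of_isIsogenous' hiso, hr]
  have hr' : W'.analyticRank ≤ 1 := by rw [hra']; exact zero_le_one
  exact TwistComparison.missingLowerBoundAt_of_isIsogenous W' W p hCassels hGZK hmod
    hiso.symm_of_charZero hr'
    (Supersingular.missingLowerBoundAt_of_casselsTate_of_selmerGroup_ne_bot W' p hCT hGZK hra' htors'
      hq' hv' hSel')

end AnyPrime

/-! ## §2 Irreducible rows: the certificate sits at the curve itself -/

section Irreducible

variable (W : WeierstrassCurve ℚ) [W.IsElliptic] (p : ℕ) [Fact p.Prime]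

/-- **L₀ at an analytic-rank-`0` curve with `W[p]` irreducible and `ord_p #Ш_an(W) ≤ 2` from ONE
non-zero `p`-Selmer class**: `p ∤ #W(ℚ)_tors` is automatic (`Supersingular.not_dvd_torsionOrder_of_irr`),
so the cell's descent lemma applies with no torsion binder and no transport. On the irreducible (t′)
rows (every `p ≥ 7` row, the `ρ̄`-onto rows at `5`, the `3`-adic-tower rows at `3`) "intrinsic" and
"shallow" are per-curve conditions (`forall_isIsogenous_shaAn_pos_iff_of_irr`,
`padicValRat_shaAn_eq_of_isIsogenous_of_irr`), so this is the whole certificate road there. Per pair;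
conditional on Cassels–Tate `hCT`, GZK `hGZK` and the certificate.
[cite: SilvermanAEC2009, Thm. X.4.14] [cite: Mazur1977, Ch. III §5, p. 157] [cite: Miller2011LMS, Def. 1.1] -/
theorem missingLowerBoundAt_rankZero_of_irr_of_selmerGroup_ne_bot
    (hCT : exists_casselsTate_pairing (K := ℚ)) (hGZK : rank_eq_analyticRank_of_analyticRank_le_one)
    (hr : W.analyticRank = 0) (hirr : Irr W p) {q : ℚ} (hq : shaAn W = (q : ℂ))
    (hv : padicValRat p q ≤ 2) (hSel : W.selmerGroup (p : ℤ) ≠ ⊥) : MissingLowerBoundAt W p :=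
  Supersingular.missingLowerBoundAt_of_casselsTate_of_selmerGroup_ne_bot W p hCT hGZK hr
    (Supersingular.not_dvd_torsionOrder_of_irr W p hirr) hq hv hSel

end Irreducible

/-! ## §3 `p = 3`: the registered BC5 rung `stub_intr_three_e4_rung` from `3`-descent certificates -/

/-- **The BC5 rung `Sig.stub_intr_three_e4_rung` of the 19618 skeleton VERBATIM — L₀ on the
`3`-adic-tower-onto intrinsic non-CM (t′) rows at `3` (Kodaira III/III*, `e = 4`) — from the PUBLISHED
inputs Cassels–Tate `hCT` and GZK `hGZK`, ONE `3`-SELMER CERTIFICATE PER SHALLOW TOWER ROW (`hSel`: on a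
tower-onto (t′) row of analytic rank `0` whose rational `#Ш_an = q` has `0 < ord₃ q ≤ 2`,
`Sel^{(3)}(W/ℚ) ≠ 0`; census: 894 classes `N < 5·10⁵`, Schaefer–Stoll `3`-descent per class), and the
DEEP tower rows displayed (`hdeep`: `ord₃ q ≥ 3` for the rational `#Ш_an(W)`; census: 7 classes with
`#Ш_an = 81`, where a first descent certifies only `ord₃ #Ш ≥ 2`).** The tower gives `W[3]` irreducible
(`n = 1`), so §2 applies at `W` itself and the class binder `hI` is used only at `W′ := W`. No
`E(ℚ₃)[3]`-binder and no cell theorem: the CT lane of the rung, next to the Kim lane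
`tameLowerHalf_three_e4_rung_of_kimAtThree_of_certs_of_typeIIIRows`. HONEST LABEL: per-pair road made
uniform by hypothesis; class-wide `hSel` is the rung's own content. Conditional; nothing credited.
[cite: SilvermanAEC2009, Thm. X.4.14] [cite: SchaeferStoll2004, §§5–6] [cite: Miller2011LMS, Def. 1.1]
[cite: Kato2004Asterisque, Conj. 12.10 (p. 224)] -/
theorem tameLowerHalf_three_e4_rung_of_selmerCerts_of_deepRows
    (hCT : exists_casselsTate_pairing (K := ℚ)) (hGZK : rank_eq_analyticRank_of_analyticRank_le_one)
    (hSel : ∀ (W : WeierstrassCurve ℚ) [W.IsElliptic] [W.IsGloballyMinimal] [Fact (3 : ℕ).Prime],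
      W.analyticRank = 0 → Addv W 3 → SubTprime W 3 →
      (∀ n : ℕ, W.HasSurjectiveModNGaloisRep (3 ^ n : ℕ)) → ¬ W.HasCM →
      ∀ q : ℚ, shaAn W = (q : ℂ) → 0 < padicValRat 3 q → padicValRat 3 q ≤ 2 →
        W.selmerGroup ((3 : ℕ) : ℤ) ≠ ⊥)
    (hdeep : ∀ (W : WeierstrassCurve ℚ) [W.IsElliptic] [W.IsGloballyMinimal] [Fact (3 : ℕ).Prime],
      W.analyticRank = 0 → Addv W 3 → SubTprime W 3 →
      (∀ n : ℕ, W.HasSurjectiveModNGaloisRep (3 ^ n : ℕ)) → ¬ W.HasCM →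
      (∀ q : ℚ, shaAn W = (q : ℂ) → 2 < padicValRat 3 q) → MissingLowerBoundAt W 3) :
    ∀ (W : WeierstrassCurve ℚ) [W.IsElliptic] [W.IsGloballyMinimal] [Fact (3 : ℕ).Prime],
      W.analyticRank = 0 → Addv W 3 → SubTprime W 3 →
      (∀ n : ℕ, W.HasSurjectiveModNGaloisRep (3 ^ n : ℕ)) → ¬ W.HasCM →
      (∀ (W' : WeierstrassCurve ℚ) [W'.IsElliptic] [W'.IsGloballyMinimal], IsIsogenous W W' →
        ∀ q' : ℚ, shaAn W' = (q' : ℂ) → 0 < padicValRat 3 q') →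
      MissingLowerBoundAt W 3 := by
  intro W _ _ _ hr hadd hT htower hCM hI
  have hirr : Irr W 3 :=
    hasIrreducibleModPGaloisRep_of_hasSurjectiveModNGaloisRep W 3 (by simpa using htower 1)
  by_cases hsh : ∃ q : ℚ, shaAn W = (q : ℂ) ∧ padicValRat 3 q ≤ 2
  · obtain ⟨q, hq, hv⟩ := hsh
    exact missingLowerBoundAt_rankZero_of_irr_of_selmerGroup_ne_bot W 3 hCT hGZK hr hirr hq hv
      (hSel W hr hadd hT htower hCM q hq (hI W (isIsogenous_self W) q hq) hv)
  · exact hdeep W hr hadd hT htower hCM fun q hq => lt_of_not_ge fun hv => hsh ⟨q, hq, hv⟩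

/-! ## §4 The open core BY NAME from one certificate per shallow class -/

/-- **`TameLowerIntrinsicNonCM` (item 19618) from the published inputs, ONE `p`-TORSION WITNESS PER
SHALLOW INTRINSIC NON-CM CLASS, and the DEEP classes displayed.** Inputs: Cassels–Tate `hCT`, Cassels
`hCassels`, GZK `hGZK`, modularity `hmod` (published); `hwit`: on every intrinsic non-CM (t′) row of
analytic rank `0` (odd additive tame `p`) whose class has SOME globally minimal member `W′` with rational
`#Ш_an(W′)` of `ord_p ≤ 2`, a nonzero `x ∈ Ш(W′)` with `p • x = 0` at such a member (the per-class
`p`-descent certificate slot: Schaefer–Stoll / `p`-isogeny descent); `hdeep`: L₀ on the rows of the DEEP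
classes (every globally minimal member has `ord_p #Ш_an ≥ 3`), displayed — there a witness certifies
only `ord_p #Ш ≥ 2`. §1 on the shallow classes. HONEST LABEL: a per-class road made uniform by
hypothesis; class-wide `hwit` is the item's own content (Kato's Conj. 12.10 lower inclusion).
Conditional; the item is NOT closed. [cite: SilvermanAEC2009, Thm. X.4.14] [cite: MilneADT2006, Thm. I.7.3]
[cite: Miller2011LMS, Def. 1.1] [cite: Kato2004Asterisque, Conj. 12.10 (p. 224)] -/
theorem tameLowerIntrinsicNonCM_of_shallowWitnesses_of_deepRows
    (hCT : exists_casselsTate_pairing (K := ℚ)) (hCassels : bsdRHS_eq_of_isIsogenous)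
    (hGZK : rank_eq_analyticRank_of_analyticRank_le_one) (hmod : hasEntireLFunction_rat)
    (hwit : ∀ (W : WeierstrassCurve ℚ) [W.IsElliptic] [W.IsGloballyMinimal] (p : ℕ) [Fact p.Prime],
      W.analyticRank = 0 → p ≠ 2 → Addv W p → SubTprime W p → ¬ W.HasCM →
      (∀ (W' : WeierstrassCurve ℚ) [W'.IsElliptic] [W'.IsGloballyMinimal], IsIsogenous W W' →
        ∀ q' : ℚ, shaAn W' = (q' : ℂ) → 0 < padicValRat p q') →
      (∃ (W' : WeierstrassCurve ℚ) (_ : W'.IsElliptic) (_ : W'.IsGloballyMinimal),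
        IsIsogenous W W' ∧ ∃ q' : ℚ, shaAn W' = (q' : ℂ) ∧ padicValRat p q' ≤ 2) →
      ∃ (W' : WeierstrassCurve ℚ) (_ : W'.IsElliptic) (_ : W'.IsGloballyMinimal),
        IsIsogenous W W' ∧ ∃ q' : ℚ, shaAn W' = (q' : ℂ) ∧ padicValRat p q' ≤ 2 ∧
          ∃ x : W'.sha, x ≠ 0 ∧ p • x = 0)
    (hdeep : ∀ (W : WeierstrassCurve ℚ) [W.IsElliptic] [W.IsGloballyMinimal] (p : ℕ) [Fact p.Prime],
      W.analyticRank = 0 → p ≠ 2 → Addv W p → SubTprime W p → ¬ W.HasCM →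
      (∀ (W' : WeierstrassCurve ℚ) [W'.IsElliptic] [W'.IsGloballyMinimal], IsIsogenous W W' →
        ∀ q' : ℚ, shaAn W' = (q' : ℂ) → 2 < padicValRat p q') → MissingLowerBoundAt W p) :
    TameLowerIntrinsicNonCM := by
  intro W _ _ p _ hr hp2 hadd hT hCM hI
  by_cases hsh : ∃ (W' : WeierstrassCurve ℚ) (_ : W'.IsElliptic) (_ : W'.IsGloballyMinimal),
      IsIsogenous W W' ∧ ∃ q' : ℚ, shaAn W' = (q' : ℂ) ∧ padicValRat p q' ≤ 2
  · obtain ⟨W', hW', hM', hiso, q', hq', hv', x, hx, hpx⟩ := hwit W p hr hp2 hadd hT hCM hI hsh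
    haveI := hW'
    haveI := hM'
    exact missingLowerBoundAt_rankZero_of_isIsogenous_shallowWitness W p W' hCT hCassels hGZK hmod hr
      hiso hq' hv' hx hpx
  · refine hdeep W p hr hp2 hadd hT hCM fun W' _ _ hiso q' hq' => lt_of_not_ge fun hv' => ?_
    exact hsh ⟨W', ‹_›, ‹_›, hiso, q', hq', hv'⟩

/-- **The same in SELMER currency**: `hSel` supplies, on every shallow intrinsic non-CM (t′) class, a
globally minimal member `W′` with `ord_p #Ш_an(W′) ≤ 2`, `p ∤ #W′(ℚ)_tors` and `Sel^{(p)}(W′/ℚ) ≠ 0`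
(at `p = 3` on the irreducible rows the torsion conjunct is automatic, §2; on the reducible rows it is
the descent seat's per-class datum). Conditional; the item is NOT closed.
[cite: SilvermanAEC2009, Thm. X.4.14] [cite: MilneADT2006, Thm. I.7.3] [cite: Miller2011LMS, Def. 1.1]
[cite: Kato2004Asterisque, Conj. 12.10 (p. 224)] -/
theorem tameLowerIntrinsicNonCM_of_shallowSelmerCerts_of_deepRows
    (hCT : exists_casselsTate_pairing (K := ℚ)) (hCassels : bsdRHS_eq_of_isIsogenous)
    (hGZK : rank_eq_analyticRank_of_analyticRank_le_one) (hmod : hasEntireLFunction_rat)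
    (hSel : ∀ (W : WeierstrassCurve ℚ) [W.IsElliptic] [W.IsGloballyMinimal] (p : ℕ) [Fact p.Prime],
      W.analyticRank = 0 → p ≠ 2 → Addv W p → SubTprime W p → ¬ W.HasCM →
      (∀ (W' : WeierstrassCurve ℚ) [W'.IsElliptic] [W'.IsGloballyMinimal], IsIsogenous W W' →
        ∀ q' : ℚ, shaAn W' = (q' : ℂ) → 0 < padicValRat p q') →
      (∃ (W' : WeierstrassCurve ℚ) (_ : W'.IsElliptic) (_ : W'.IsGloballyMinimal),
        IsIsogenous W W' ∧ ∃ q' : ℚ, shaAn W' = (q' : ℂ) ∧ padicValRat p q' ≤ 2) →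
      ∃ (W' : WeierstrassCurve ℚ) (_ : W'.IsElliptic) (_ : W'.IsGloballyMinimal),
        IsIsogenous W W' ∧ ¬ p ∣ W'.torsionOrder ∧ W'.selmerGroup (p : ℤ) ≠ ⊥ ∧
          ∃ q' : ℚ, shaAn W' = (q' : ℂ) ∧ padicValRat p q' ≤ 2)
    (hdeep : ∀ (W : WeierstrassCurve ℚ) [W.IsElliptic] [W.IsGloballyMinimal] (p : ℕ) [Fact p.Prime],
      W.analyticRank = 0 → p ≠ 2 → Addv W p → SubTprime W p → ¬ W.HasCM →
      (∀ (W' : WeierstrassCurve ℚ) [W'.IsElliptic] [W'.IsGloballyMinimal], IsIsogenous W W' →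
        ∀ q' : ℚ, shaAn W' = (q' : ℂ) → 2 < padicValRat p q') → MissingLowerBoundAt W p) :
    TameLowerIntrinsicNonCM := by
  intro W _ _ p _ hr hp2 hadd hT hCM hI
  by_cases hsh : ∃ (W' : WeierstrassCurve ℚ) (_ : W'.IsElliptic) (_ : W'.IsGloballyMinimal),
      IsIsogenous W W' ∧ ∃ q' : ℚ, shaAn W' = (q' : ℂ) ∧ padicValRat p q' ≤ 2
  · obtain ⟨W', hW', hM', hiso, htors', hSel', q', hq', hv'⟩ := hSel W p hr hp2 hadd hT hCM hI hsh
    haveI := hW'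
    haveI := hM'
    exact missingLowerBoundAt_rankZero_of_isIsogenous_shallowSelmer W p W' hCT hCassels hGZK hmod hr
      hiso htors' hq' hv' hSel'
  · refine hdeep W p hr hp2 hadd hT hCM fun W' _ _ hiso q' hq' => lt_of_not_ge fun hv' => ?_
    exact hsh ⟨W', ‹_›, ‹_›, hiso, q', hq', hv'⟩

end Summit.BirchSwinnertonDyer.BirchSwinnertonDyer.Theorems

end
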